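import Literature.MathematicalPhysics.QuantumFieldTheory.Balaban1983to89.B9RWSumsCompleteGeo9Y

/-!
# `Balaban1983to89.B9RWSumsDefinitePins` — [B9] rows 13 ∕ 18 ∕ 19 of the N06 census as ONE face with DEFINITE expansion data:
# the primitive constants of a side as a record (`PinPrims`, signs `PinPrims.OK`), the all-blocks constants shared by the two pins
# BY CHOICE (`B1Y`, `delta1Y`, `BbetaY`, `BepsY`, `BepsbetaY`), the definite E-letters `E37Y` ∕ `E310Y` over def-Y's members, and
# Theorem 3.7 ∧ Corollary 3.8 ∧ Theorem 3.10 ∧ the summation leaf from the operator-level inputs and the two sign records alone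

T. Bałaban, *Propagators for lattice gauge theories in a background field*, Commun. Math. Phys. **99** (1985) 389–434
[`Balaban1985BackgroundPropagators`, "B9"], Thm 3.7 (3.90) p. 409, Cor. 3.8 (3.94) p. 410, Thm 3.10 (3.107)–(3.108) pp. 415–416,
p. 410 *"Theorem 3.7 implies that all the inequalities (3.42)–(3.47) hold for G′"*, p. 416 *"This implies Theorem 3.3"*, and
Thms 3.1 ∕ 3.3 p. 397–399: *"There exist positive constants B₀, δ₀, B₀(β), B′₀(ε), B′₀(ε, β) dependent on d and L only … such
that for M sufficiently large and for arbitrary {Ω_j} … the following inequalities hold"*; [4] = T. Bałaban, *Propagators and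
renormalization transformations for lattice gauge theories. II*, Commun. Math. Phys. **96** (1984) 223–250
[`Balaban1984PropagatorsII`], Lemma 2.1 pp. 233–234.

statement-level skeleton of published theorems with citation tags; proofs where landed; nothing here is a claim about the
Yang–Mills mass gap

THE POINT.  The sibling `B9RWSumsCompleteGeo9Y` composes the all-blocks leaves of rows 13∕18∕19 at the geometry of record from
operator-level inputs; what it still DISPLAYS besides those are (a) ≈ 25 sign facts of the primitive constants per side and
(b) ≈ 10 RELATIONS per side tying the all-blocks constants (B₁, δ₁, B₀(β), B′₀(ε), B′₀(ε, β)) — which Theorems 3.1 ∕ 3.3 state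
EXISTENTIALLY (*"There exist positive constants …"*) but which the N06 certificate must PIN as data of the E-letters
`(ops x).E37`, `(ops x).E310`, the SAME five constants in both pins (the summation leaf `B9.RWSumsYieldIneqs` quantifies them
once for G′ and G).  THIS FILE chooses them: the least admissible choice is a `max` ∕ `min` over the two sides' derived constants,
so every relation holds BY CONSTRUCTION and positivity is PROVED.

* §1 `PinPrims` — one side's primitive constants (DATA: the split exponents α, α_F, Cor. 3.6's (B₀, δ₀, a₁, M₁), the static sizes
  ρ, N_c, N′, N_F, C_ℓ, K_c, θ₀, the leg constants N_H, N_L, B_L, N_I, N₂, B₂, θ₂, B_l(·), B_t(·), B_I(·), θ_I(·), B_I(·,·));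
  `PinPrims.OK` — their signs (0 < α < ½, 0 < α_F < ½, 1 ≦ C_ℓ, 0 < B₀, δ₀, a₁, M₁, the rest ≧ 0); `PinPrims.C p d` = `const37 d …`.
* §2 the definite shared constants: `pinLowerB` (the five lower bounds a side puts on B₁: C, C·L₀, C·c₁(d_F)·L₀⁴, √(C·lapConst)·L₀,
  twoConst), `PinPrims.lowerB`, ★ `B1Y p q … := max 1 (max lowerB_{G′} lowerB_G)`, ★ `delta1Y p q := min ((1 − 2α_F)(1 − 2α)δ₀)_{G′} (…)_G`,
  ★ `BbetaY` ∕ `BepsY` ∕ `BepsbetaY` (pointwise max of the two sides' `holderConst` ∕ `inputConst44` ∕ `inputConst45`), with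
  `B1Y_pos`, `delta1Y_pos` and the relation lemmas.
* §3 at def-Y's members: the DEFINITE E-LETTERS ★ `E37Y p q 𝔬 rd H K` = `E37AllOfOps (W38OfOps 𝔬 rd 1 H C δ) 𝔬 1 H C δ K B1Y delta1Y
  BbetaY BepsY BepsbetaY` (C = `p.C (exp261 geo9Y p.δ₀ p.α)`, δ = (1 − 2α)δ₀, exponents `exp261 geo9Y …` of `B9RWSums347DefiniteFaces`,
  L₀ = ℓ + 1) and ★ `E310Y p q 𝔬 rd H K` = `W310OfOps 𝔬 rd (ConvAll3107 𝔬 1 H C_G δ_G K B1Y delta1Y BbetaY BepsY BepsbetaY)`.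
* §4 ★★★ `rows131819_definite_geo9Y` — `B9.Thm37Printed c35 geo9Y bg (fun x => E37Y p q (𝔬 x) (rd x) (H x) (K x)) ∧ B9.Cor38Printed
  c35 geo9Y bg (same) ∧ B9.Thm310Printed c35 geo9Y bg (fun x => E310Y p q (𝔬A x) (rdA x) (H x) (KA x)) ∧ B9.RWSumsYieldIneqs geo9Y bg
  (E37Y …) (E310Y …) K KA` from `hp : p.OK`, `hq : q.OK` and the OPERATOR-LEVEL inputs of both sides only (static data, Corollary
  3.6's packages `h36`∕`h36H` per side, the co-readings of `K` ∕ `KA`, the transpose letters, the support counts) — NO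
  constants-relation binder, NO positivity binder for (B₁, δ₁), NO geometry binder, NO sign binder beyond `hp`, `hq` (and `0 < c35`).

So the certificate may pin `(ops x).E37 = E37Y p q …`, `(ops x).E310 = E310Y p q …` and take rows 13∕18∕19 from ONE application.

HONEST SCOPE.  Definitions by choice + kernel bookkeeping over landed modules; nothing of [B9] or [4] is asserted: Corollary 3.6 for
the local operators, the structure of the expansions, (3.89), the Hölder ∕ Laplacian ∕ input ∕ L² legs, the static sizes and the
readings remain HYPOTHESES of printed shape exactly as in the landed leaves.  The chosen constants are α-dependent O(1)'s of the
tree's calculus, NOT print's B₀(β) etc.  NOT a node discharge; count-neutral; one finite 𝕋⁴ programme at fixed ε — nothing continuum,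
nothing about the mass gap.  Cell `pub-ymgap` (HUMAN RULING D-0062), Track A node N06 [B9], N06-ASSIGNMENT v1 bundle F6 (rows 18–19),
seat `pub-ymgap-dag-n06-k` (gen 3), 2026-08-27.
-/

noncomputable section

namespace Literature.MathematicalPhysics.QuantumFieldTheory.Balaban1983to89.B9RWSumsDefinitePins

open Literature.MathematicalPhysics.QuantumFieldTheory.Balaban1983to89
open Finset B6RandomWalk B9Thm34Ext B9Thm37Whole B9Cor38Whole B9Thm310Whole B9RowSum261Faces B9RowSum261DefiniteFaces
open B9Ineq349Whole B9RWSums343to347Whole B9PinMembersKLevelV1 B9GeoLemma21KLevelV1 B9RWSums347DefiniteFaces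
open B9Thm37GlueCor36 B9Thm37Glue B9RWSums346Schur B9RWSums343Holder B9RWSums343HolderGp B9RWSums346Lap B9RWSums344Input
open B9RWSums344InputGp B9RWSums346Two B9RWSums346TwoGp B11SectG B9RWSumsCompleteGeo9Y

/-! ## §1 One side's primitive constants and their signs -/

/-- **THE PRIMITIVE CONSTANTS OF ONE SIDE** (G′ ∕ Theorem 3.7 or G ∕ Theorem 3.10) of rows 13∕18∕19 — DATA: the door ∕ Cor.-3.6
split exponent α and the (3.47) split exponent α_F; Corollary 3.6's constant and rate (B₀, δ₀) and provisos (a₁, M₁) (p. 408);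
the static sizes ρ, N_c, N′, N_F, C_ℓ, K_c, θ₀ of (3.88)–(3.89) ∕ (3.105) (p. 409, p. 413); the leg constants of the Hölder ∕ Laplacian ∕
input ∕ L² members (N_H, N_L, B_L, N_I, N₂, B₂, θ₂ and the functions B_l, B_t (= B_V on the G′ side, θ_H on the G side), B_I, θ_I, B_I(·,·)).
A record of letters; nothing asserted. [cite: Balaban1985BackgroundPropagators, Cor. 3.6 p.408 + (3.88)–(3.89) p.409 + p.413 + Thm 3.1 p.397 («positive constants B₀, δ₀, B₀(β), B′₀(ε), B′₀(ε,β)»)] -/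
structure PinPrims where
  (α ρ Nc N' NF Cℓ Kc θ₀ B₀ δ₀ a₁ M₁ αF NH NL BL NI N2 B2 θ2 : ℝ)
  (Bl Bt BI θI : ℝ → ℝ)
  (BI2 : ℝ → ℝ → ℝ)

/-- **THE SIGNS OF ONE SIDE'S PRIMITIVE CONSTANTS**: 0 < α < ½, 0 < α_F < ½, 1 ≦ C_ℓ, 0 < B₀, δ₀, a₁, M₁, every count and size ≧ 0,
and the leg functions ≧ 0 on their windows.  A hypothesis schema. [cite: Balaban1985BackgroundPropagators, Thm 3.1 p.397 + Cor. 3.6 p.408 (bookkeeping)] -/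
structure PinPrims.OK (p : PinPrims) : Prop where
  α_pos : 0 < p.α
  α_lt : p.α < 1 / 2
  Nc_nn : 0 ≤ p.Nc
  N'_nn : 0 ≤ p.N'
  NF_nn : 0 ≤ p.NF
  one_le_Cℓ : 1 ≤ p.Cℓ
  Kc_nn : 0 ≤ p.Kc
  θ₀_nn : 0 ≤ p.θ₀
  B₀_pos : 0 < p.B₀
  δ₀_pos : 0 < p.δ₀
  a₁_pos : 0 < p.a₁
  M₁_pos : 0 < p.M₁
  αF_pos : 0 < p.αF
  αF_lt : p.αF < 1 / 2
  NH_nn : 0 ≤ p.NH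
  NL_nn : 0 ≤ p.NL
  BL_nn : 0 ≤ p.BL
  NI_nn : 0 ≤ p.NI
  N2_nn : 0 ≤ p.N2
  B2_nn : 0 ≤ p.B2
  θ2_nn : 0 ≤ p.θ2
  Bl_nn : ∀ β, 0 ≤ β → β < 1 → 0 ≤ p.Bl β
  Bt_nn : ∀ β, 0 ≤ β → β < 1 → 0 ≤ p.Bt β
  BI_nn : ∀ ε, 0 < ε → ε ≤ 1 → 0 ≤ p.BI ε
  BI2_nn : ∀ ε β, 0 < ε → ε ≤ 1 → 0 ≤ β → β < 1 → 0 ≤ p.BI2 ε β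
  θI_nn : ∀ ε, 0 < ε → 0 ≤ p.θI ε

/-- the sup-block constant of a side at an exponent: `C = const37 d δ₀ α ρ B₀ N_c N′ C_ℓ K_c`.
[cite: Balaban1985BackgroundPropagators, Thm 3.7 pp.409–410 (bookkeeping)] -/
def PinPrims.C (p : PinPrims) (dd : ℕ) : ℝ := const37 dd p.δ₀ p.α p.ρ p.B₀ p.Nc p.N' p.Cℓ p.Kc

/-- `0 ≤ p.C d`. [cite: Balaban1985BackgroundPropagators, Thm 3.7 pp.409–410 (bookkeeping)] -/
theorem PinPrims.C_nonneg {p : PinPrims} (hp : p.OK) (dd : ℕ) : 0 ≤ p.C dd :=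
  const37_nonneg_of_signs dd hp.B₀_pos.le hp.Nc_nn hp.N'_nn (zero_le_one.trans hp.one_le_Cℓ) hp.Kc_nn

/-- `0 < (1 − 2α)δ₀` for a side. [cite: Balaban1985BackgroundPropagators, Thm 3.7 pp.409–410 (bookkeeping)] -/
theorem PinPrims.rate_pos {p : PinPrims} (hp : p.OK) : 0 < (1 - 2 * p.α) * p.δ₀ :=
  mul_pos (by linarith [hp.α_lt]) hp.δ₀_pos

/-! ## §2 The all-blocks constants shared by the two pins, BY CHOICE -/

/-- **The five lower bounds one side puts on the all-blocks constant B₁**: C (the (3.42) clauses), C·L₀ (the (3.46)₁₂₃ Schur lines),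
C·c₁(d_F)·L₀⁴ (the (3.47) passage), √(C·lapConst)·L₀ (the (3.46)₃₅ lines), twoConst (the two-sided line) — their maximum.
[cite: Balaban1985BackgroundPropagators, Thm 3.1 p.397 + (3.42)–(3.47) pp.397–398 (bookkeeping)] -/
def pinLowerB (C cF lapC twoC L₀ : ℝ) : ℝ :=
  max (max (max (max C (C * L₀)) (C * cF * L₀ ^ (4 : ℝ))) (Real.sqrt (C * lapC) * L₀)) twoC

/-- `C ≤ pinLowerB …`. [folklore] -/
private theorem le_pinLowerB₁ (C cF lapC twoC L₀ : ℝ) : C ≤ pinLowerB C cF lapC twoC L₀ :=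
  (le_max_left _ _).trans ((le_max_left _ _).trans ((le_max_left _ _).trans (le_max_left _ _)))

/-- `C·L₀ ≤ pinLowerB …`. [folklore] -/
private theorem le_pinLowerB₂ (C cF lapC twoC L₀ : ℝ) : C * L₀ ≤ pinLowerB C cF lapC twoC L₀ :=
  (le_max_right _ _).trans ((le_max_left _ _).trans ((le_max_left _ _).trans (le_max_left _ _)))

/-- `C·c_F·L₀⁴ ≤ pinLowerB …`. [folklore] -/
private theorem le_pinLowerB₃ (C cF lapC twoC L₀ : ℝ) : C * cF * L₀ ^ (4 : ℝ) ≤ pinLowerB C cF lapC twoC L₀ :=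
  (le_max_right _ _).trans ((le_max_left _ _).trans (le_max_left _ _))

/-- `√(C·lapC)·L₀ ≤ pinLowerB …`. [folklore] -/
private theorem le_pinLowerB₄ (C cF lapC twoC L₀ : ℝ) : Real.sqrt (C * lapC) * L₀ ≤ pinLowerB C cF lapC twoC L₀ :=
  (le_max_right _ _).trans (le_max_left _ _)

/-- `twoC ≤ pinLowerB …`. [folklore] -/
private theorem le_pinLowerB₅ (C cF lapC twoC L₀ : ℝ) : twoC ≤ pinLowerB C cF lapC twoC L₀ :=
  le_max_right _ _

/-- **One side's lower bound on B₁** at the exponents (d, d_F) with the factor count `nF` (N′ on the G′ side, N_F on the G side) and the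
lattice bound L₀. [cite: Balaban1985BackgroundPropagators, Thm 3.1 p.397 (bookkeeping)] -/
def PinPrims.lowerB (p : PinPrims) (dd dF : ℕ) (nF L₀ : ℝ) : ℝ :=
  pinLowerB (p.C dd) (B6.c1 dF ((1 - 2 * p.α) * p.δ₀) (1 - p.αF)) (lapConst dd p.δ₀ p.α p.NL p.BL L₀)
    (twoConst dd p.δ₀ p.α p.N2 p.B2 nF p.θ2 (p.C dd) L₀) L₀

/-- ★ **THE ALL-BLOCKS CONSTANT B₁, BY CHOICE**: `max 1 (max lowerB_{G′} lowerB_G)` (≥ 1, above both sides' five lower bounds).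
[cite: Balaban1985BackgroundPropagators, Thm 3.1 p.397 + Thm 3.3 p.399 («There exist positive constants B₀ …»)] -/
def B1Y (p q : PinPrims) (dp dFp dq dFq : ℕ) (L₀ : ℝ) : ℝ :=
  max 1 (max (p.lowerB dp dFp p.N' L₀) (q.lowerB dq dFq q.NF L₀))

/-- `0 < B1Y …` (the chosen all-blocks constant is positive, as Theorems 3.1 ∕ 3.3 require).
[cite: Balaban1985BackgroundPropagators, Thm 3.1 p.397 («There exist positive constants B₀ …»), bookkeeping] -/
theorem B1Y_pos (p q : PinPrims) (dp dFp dq dFq : ℕ) (L₀ : ℝ) : 0 < B1Y p q dp dFp dq dFq L₀ :=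
  lt_of_lt_of_le one_pos (le_max_left _ _)

/-- the G′ side's lower bound is below `B1Y`. [folklore] -/
private theorem lowerB_le_B1Y_left (p q : PinPrims) (dp dFp dq dFq : ℕ) (L₀ : ℝ) :
    p.lowerB dp dFp p.N' L₀ ≤ B1Y p q dp dFp dq dFq L₀ :=
  (le_max_left _ _).trans (le_max_right _ _)

/-- the G side's lower bound is below `B1Y`. [folklore] -/
private theorem lowerB_le_B1Y_right (p q : PinPrims) (dp dFp dq dFq : ℕ) (L₀ : ℝ) :
    q.lowerB dq dFq q.NF L₀ ≤ B1Y p q dp dFp dq dFq L₀ :=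
  (le_max_right _ _).trans (le_max_right _ _)

/-- ★ **THE ALL-BLOCKS RATE δ₁, BY CHOICE**: `min ((1 − 2α_F)(1 − 2α)δ₀)_{G′} ((1 − 2α_F)(1 − 2α)δ₀)_G`.
[cite: Balaban1985BackgroundPropagators, Thm 3.1 p.397 + Thm 3.3 p.399 («positive constants … δ₀»)] -/
def delta1Y (p q : PinPrims) : ℝ :=
  min ((1 - 2 * p.αF) * ((1 - 2 * p.α) * p.δ₀)) ((1 - 2 * q.αF) * ((1 - 2 * q.α) * q.δ₀))

/-- `0 < delta1Y p q` under the signs (the chosen all-blocks rate is positive, as Theorems 3.1 ∕ 3.3 require).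
[cite: Balaban1985BackgroundPropagators, Thm 3.1 p.397 («positive constants … δ₀»), bookkeeping] -/
theorem delta1Y_pos {p q : PinPrims} (hp : p.OK) (hq : q.OK) : 0 < delta1Y p q :=
  lt_min (mul_pos (by linarith [hp.αF_lt]) (PinPrims.rate_pos hp)) (mul_pos (by linarith [hq.αF_lt]) (PinPrims.rate_pos hq))

/-- ★ **B₀(β) BY CHOICE**: the pointwise maximum of the two sides' Hölder constants `holderConst`.
[cite: Balaban1985BackgroundPropagators, Thm 3.1 p.397 («B₀(β)») + (3.43) p.398] -/
def BbetaY (p q : PinPrims) (dp dq : ℕ) : ℝ → ℝ := fun β =>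
  max (holderConst dp p.δ₀ p.α p.NH p.N' (p.C dp) (p.Bl β) (p.Bt β))
    (holderConst dq q.δ₀ q.α q.NH q.NF (q.C dq) (q.Bl β) (q.Bt β))

/-- ★ **B′₀(ε) BY CHOICE**: the pointwise maximum of the two sides' `inputConst44`.
[cite: Balaban1985BackgroundPropagators, Thm 3.1 p.397 («B′₀(ε)») + (3.44) p.398] -/
def BepsY (p q : PinPrims) (dp dq : ℕ) (L₀ : ℝ) : ℝ → ℝ := fun ε =>
  max (inputConst44 dp p.δ₀ p.α p.NI p.N' (p.C dp) L₀ (p.BI ε) (p.θI ε))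
    (inputConst44 dq q.δ₀ q.α q.NI q.NF (q.C dq) L₀ (q.BI ε) (q.θI ε))

/-- ★ **B′₀(ε, β) BY CHOICE**: the pointwise maximum of the two sides' `inputConst45`.
[cite: Balaban1985BackgroundPropagators, Thm 3.1 p.397 («B′₀(ε,β)») + (3.45) p.398] -/
def BepsbetaY (p q : PinPrims) (dp dq : ℕ) (L₀ : ℝ) : ℝ → ℝ → ℝ := fun ε β =>
  max (inputConst45 dp p.δ₀ p.α p.NI p.N' L₀ (holderConst dp p.δ₀ p.α p.NH p.N' (p.C dp) (p.Bl β) (p.Bt β)) (p.BI2 ε β)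
      (p.θI (β + ε)))
    (inputConst45 dq q.δ₀ q.α q.NI q.NF L₀ (holderConst dq q.δ₀ q.α q.NH q.NF (q.C dq) (q.Bl β) (q.Bt β)) (q.BI2 ε β)
      (q.θI (β + ε)))

/-! ## §3 At def-Y's members: the definite E-letters of rows 13∕18∕19 -/

section StageY

variable {d ℓ : ℕ} {hd : 1 ≤ d + 1} {hL : Odd (ℓ + 1) ∧ 1 < ℓ + 1} {b₀ b₁ : ℝ} {Mstar : ℕ}
variable [∀ x : MemberY d ℓ hd hL b₀ b₁ Mstar, Fintype (geo9Y x).Site]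
  [∀ x : MemberY d ℓ hd hL b₀ b₁ Mstar, DecidableEq (geo9Y x).Site]
variable {c35 : ℝ} {bg : MemberY d ℓ hd hL b₀ b₁ Mstar → B9.Backgrounds}

/-- ★ **THE DEFINITE E-LETTER OF THEOREM 3.7 ∕ COROLLARY 3.8 AT A MEMBER** (rows 13 and 19's G′ half): n06-c's walk datum
`W38OfOps 𝔬 rd 1 H C δ` (Corollary 3.8's terms (3.90) and readings) with the (3.42) predicate at the literal constants C =
`p.C (exp261 geo9Y p.δ₀ p.α)`, δ = (1 − 2α)δ₀, strengthened to the all-blocks predicate `E37AllOfOps … K B₁ δ₁ B₀(·) B′₀(·) B′₀(·,·)` at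
the definite shared constants of §2 (exponents `exp261 geo9Y …`, L₀ = ℓ + 1).  OURS (a pin target for `(ops x).E37`).
[cite: Balaban1985BackgroundPropagators, Thm 3.7 (3.90) p.409 + Cor. 3.8 (3.93)–(3.94) p.410 + Thm 3.1 (3.42)–(3.47) pp.397–398] -/
def E37Y (p q : PinPrims) {x : MemberY d ℓ hd hL b₀ b₁ Mstar} {X Y ι : Type} (𝔬 : Ops (geo9Y x) (bg x) X Y ι)
    (rd : WalkReading (geo9Y x) (bg x) X ι) (H : Prop) (K : B9.KernelFamily (geo9Y x) (bg x)) :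
    B9.RWExpansion (geo9Y x) (bg x) :=
  E37AllOfOps
    (W38OfOps 𝔬 rd 1 H (p.C (exp261 (@geo9Y d ℓ hd hL b₀ b₁ Mstar) p.δ₀ p.α)) ((1 - 2 * p.α) * p.δ₀))
    𝔬 1 H (p.C (exp261 (@geo9Y d ℓ hd hL b₀ b₁ Mstar) p.δ₀ p.α)) ((1 - 2 * p.α) * p.δ₀) K
    (B1Y p q (exp261 (@geo9Y d ℓ hd hL b₀ b₁ Mstar) p.δ₀ p.α)
      (exp261 (@geo9Y d ℓ hd hL b₀ b₁ Mstar) ((1 - 2 * p.α) * p.δ₀) (1 - p.αF))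
      (exp261 (@geo9Y d ℓ hd hL b₀ b₁ Mstar) q.δ₀ q.α)
      (exp261 (@geo9Y d ℓ hd hL b₀ b₁ Mstar) ((1 - 2 * q.α) * q.δ₀) (1 - q.αF)) ((ℓ + 1 : ℕ) : ℝ))
    (delta1Y p q)
    (BbetaY p q (exp261 (@geo9Y d ℓ hd hL b₀ b₁ Mstar) p.δ₀ p.α) (exp261 (@geo9Y d ℓ hd hL b₀ b₁ Mstar) q.δ₀ q.α))
    (BepsY p q (exp261 (@geo9Y d ℓ hd hL b₀ b₁ Mstar) p.δ₀ p.α) (exp261 (@geo9Y d ℓ hd hL b₀ b₁ Mstar) q.δ₀ q.α)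
      ((ℓ + 1 : ℕ) : ℝ))
    (BepsbetaY p q (exp261 (@geo9Y d ℓ hd hL b₀ b₁ Mstar) p.δ₀ p.α) (exp261 (@geo9Y d ℓ hd hL b₀ b₁ Mstar) q.δ₀ q.α)
      ((ℓ + 1 : ℕ) : ℝ))

/-- ★ **THE DEFINITE E-LETTER OF THEOREM 3.10 AT A MEMBER** (rows 18 and 19's G half): this seat's `W310OfOps 𝔬 rd (ConvAll3107 𝔬 1 H
C_G δ_G K B₁ δ₁ …)` at C_G = `q.C (exp261 geo9Y q.δ₀ q.α)`, δ_G = (1 − 2α)δ₀ of the G side and the definite shared constants of §2.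
OURS (a pin target for `(ops x).E310`). [cite: Balaban1985BackgroundPropagators, Thm 3.10 (3.107)–(3.108) pp.415–416 + Thm 3.3 p.399] -/
def E310Y (p q : PinPrims) {x : MemberY d ℓ hd hL b₀ b₁ Mstar} {X Y ι A : Type} (𝔬 : Ops310 (geo9Y x) (bg x) X Y ι A)
    (rd : WalkReading310 (geo9Y x) (bg x) X ι A) (H : Prop) (K : B9.KernelFamily (geo9Y x) (bg x)) :
    B9.RWExpansion (geo9Y x) (bg x) :=
  W310OfOps 𝔬 rd
    (ConvAll3107 𝔬 1 H (q.C (exp261 (@geo9Y d ℓ hd hL b₀ b₁ Mstar) q.δ₀ q.α)) ((1 - 2 * q.α) * q.δ₀) K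
      (B1Y p q (exp261 (@geo9Y d ℓ hd hL b₀ b₁ Mstar) p.δ₀ p.α)
        (exp261 (@geo9Y d ℓ hd hL b₀ b₁ Mstar) ((1 - 2 * p.α) * p.δ₀) (1 - p.αF))
        (exp261 (@geo9Y d ℓ hd hL b₀ b₁ Mstar) q.δ₀ q.α)
        (exp261 (@geo9Y d ℓ hd hL b₀ b₁ Mstar) ((1 - 2 * q.α) * q.δ₀) (1 - q.αF)) ((ℓ + 1 : ℕ) : ℝ))
      (delta1Y p q)
      (BbetaY p q (exp261 (@geo9Y d ℓ hd hL b₀ b₁ Mstar) p.δ₀ p.α) (exp261 (@geo9Y d ℓ hd hL b₀ b₁ Mstar) q.δ₀ q.α))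
      (BepsY p q (exp261 (@geo9Y d ℓ hd hL b₀ b₁ Mstar) p.δ₀ p.α) (exp261 (@geo9Y d ℓ hd hL b₀ b₁ Mstar) q.δ₀ q.α)
        ((ℓ + 1 : ℕ) : ℝ))
      (BepsbetaY p q (exp261 (@geo9Y d ℓ hd hL b₀ b₁ Mstar) p.δ₀ p.α) (exp261 (@geo9Y d ℓ hd hL b₀ b₁ Mstar) q.δ₀ q.α)
        ((ℓ + 1 : ℕ) : ℝ)))

/-! ## §4 Rows 13 ∕ 18 ∕ 19 as ONE face at the definite E-letters -/

/-- ★★★ **ROWS 13 ∕ 18 ∕ 19 OF THE N06 CENSUS AT def-Y's MEMBERS WITH DEFINITE EXPANSION DATA — Theorem 3.7 ∧ Corollary 3.8 at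
`E37Y`, Theorem 3.10 at `E310Y`, and the summation leaf `B9.RWSumsYieldIneqs` for the pair, from the two sign records and the
OPERATOR-LEVEL inputs alone.**  G′ side (letters `𝔬 rd 𝔭 bH`, kernel family `K`, evaluations `ev evY`, sizes `κ`, supports `SH SL
SI S2`, primitives `p`): the static data (`StaticOK`, `Sizes.Bounded`, `WalkReading.OK`, `Locality`), Corollary 3.6's blocks and the
structure (3.88) (`h36`) and the seven leg schemas (`h36H`) for M ≧ M₁, 0 < α₀, O(1)Mα₀ ≦ a₁, (3.35) — POSITED —, the co-readings of
`K x`, the transpose letters, the support counts; G side (suffix `A`, primitives `q`): the same for Theorem 3.10's letters.  Inside: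
`thm37_cor38_complete_geo9Y` ∕ `thm310_complete_geo9Y` at B₁ := `B1Y …`, δ₁ := `delta1Y p q`, B₀(·) := `BbetaY …`, B′₀(·) := `BepsY …`,
B′₀(·,·) := `BepsbetaY …` — every relation by `le_max_…` ∕ `min_le_…`, positivity by `B1Y_pos` ∕ `delta1Y_pos` — and
`rwSumsYieldIneqs_allPins`.  Nothing of print asserted; NOT a node discharge. [cite: Balaban1985BackgroundPropagators, Thm 3.7 p.409 + Cor. 3.8 p.410 + Thm 3.10 pp.415–416 + Thm 3.7 ⇒ Thm 3.1 p.410 + Thm 3.10 ⇒ Thm 3.3 p.416 + Cor. 3.6 p.408; Balaban1984PropagatorsII, Lemma 2.1 pp.233–234] -/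
theorem rows131819_definite_geo9Y {X Y ι PX PY XA YA ιA AA PXA PYA : MemberY d ℓ hd hL b₀ b₁ Mstar → Type}
    [∀ x, Fintype (X x)] [∀ x, DecidableEq (X x)] [∀ x, Fintype (Y x)] [∀ x, DecidableEq (Y x)] [∀ x, Fintype (ι x)]
    [∀ x, Fintype (PX x)] [∀ x, DecidableEq (PX x)] [∀ x, Fintype (PY x)] [∀ x, DecidableEq (PY x)]
    [∀ x, Fintype (XA x)] [∀ x, DecidableEq (XA x)] [∀ x, Fintype (YA x)] [∀ x, DecidableEq (YA x)] [∀ x, Fintype (ιA x)]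
    [∀ x, Fintype (AA x)] [∀ x, Fintype (PXA x)] [∀ x, DecidableEq (PXA x)] [∀ x, Fintype (PYA x)] [∀ x, DecidableEq (PYA x)]
    (p q : PinPrims) (hp : p.OK) (hq : q.OK) (hc : 0 < c35) (H : MemberY d ℓ hd hL b₀ b₁ Mstar → Prop)
    -- the G′ side (Theorem 3.7 ∕ Corollary 3.8)
    (𝔬 : ∀ x : MemberY d ℓ hd hL b₀ b₁ Mstar, Ops (geo9Y x) (bg x) (X x) (Y x) (ι x))
    (rd : ∀ x : MemberY d ℓ hd hL b₀ b₁ Mstar, WalkReading (geo9Y x) (bg x) (X x) (ι x))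
    (𝔭 : ∀ x : MemberY d ℓ hd hL b₀ b₁ Mstar, HolderProbes (geo9Y x) (bg x) (X x) (Y x) (PX x) (PY x))
    (bH : ∀ x : MemberY d ℓ hd hL b₀ b₁ Mstar, ℝ → BlockNorm (toB6 (geo9Y x) 1 (H x)) (Y x → ℝ))
    (K : ∀ x : MemberY d ℓ hd hL b₀ b₁ Mstar, B9.KernelFamily (geo9Y x) (bg x))
    (ev : ∀ x : MemberY d ℓ hd hL b₀ b₁ Mstar, (geo9Y x).Loc → X x → ℝ)
    (evY : ∀ x : MemberY d ℓ hd hL b₀ b₁ Mstar, (geo9Y x).Loc → Y x → ℝ)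
    (κ : MemberY d ℓ hd hL b₀ b₁ Mstar → Sizes) (SH SL SI S2 : ∀ x : MemberY d ℓ hd hL b₀ b₁ Mstar, ι x → Finset (geo9Y x).Site)
    (hst : ∀ x, StaticOK (𝔬 x) p.ρ p.Nc p.N' p.Cℓ (κ x)) (hκ : ∀ x, (κ x).Bounded p.Kc p.θ₀ p.Cℓ (geo9Y x).M)
    (hrd : ∀ x, (rd x).OK (𝔬 x).blk) (hloc : ∀ x, Locality (𝔬 x) (rd x))
    (h36 : ∀ x, p.M₁ ≤ (geo9Y x).M → ∀ α₀ : ℝ, 0 < α₀ → c35 * (geo9Y x).M * α₀ ≤ p.a₁ →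
      ∀ U : (bg x).Cfg, (bg x).Reg335 c35 α₀ U → Local342 (𝔬 x) 1 (H x) p.B₀ p.δ₀ U ∧ Identities (𝔬 x) 1 (H x) U)
    (h36H : ∀ x, p.M₁ ≤ (geo9Y x).M → ∀ α₀ : ℝ, 0 < α₀ → c35 * (geo9Y x).M * α₀ ≤ p.a₁ →
      ∀ U : (bg x).Cfg, (bg x).Reg335 c35 α₀ U →
        HolderLegs37 (𝔬 x) (𝔭 x) 1 (H x) (SH x) p.Bl p.δ₀ U ∧ HolderV37 (𝔬 x) (𝔭 x) 1 (H x) p.Bt p.δ₀ U ∧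
          LapLegs37 (𝔬 x) 1 (H x) (SL x) p.BL p.δ₀ U ∧
            InputLegs37 (𝔬 x) (𝔭 x) 1 (H x) (bH x) (SI x) p.BI p.BI2 p.δ₀ U ∧ FactorsInput37 (𝔬 x) 1 (H x) (bH x) p.θI p.δ₀ U ∧
              L2TwoLegs37 (𝔬 x) 1 (H x) (S2 x) p.B2 p.δ₀ U ∧ FactorsL2_37 (𝔬 x) 1 (H x) p.θ2 p.δ₀ U)
    (hco0 : ∀ x U, CoRealizes (K x) 0 U (𝔬 x).blk (𝔬 x).blk (ev x) ((𝔬 x).Gp U))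
    (hco1 : ∀ x U, CoRealizes (K x) 1 U (𝔬 x).blkY (𝔬 x).blk (ev x) ((𝔬 x).D U ∘ₗ (𝔬 x).Gp U))
    (hco2 : ∀ x U, CoRealizes (K x) 2 U (𝔬 x).blk (𝔬 x).blkY (evY x) ((𝔬 x).Gp U ∘ₗ (𝔬 x).Dstar U))
    (hco3 : ∀ x U, CoRealizes (K x) 3 U (𝔬 x).blk (𝔬 x).blk (ev x) ((𝔬 x).Lap U ∘ₗ (𝔬 x).Gp U))
    (hgl0 : ∀ x U, GlobReads (K x) 0 U (𝔬 x).blk (𝔬 x).blk (ev x) ((𝔬 x).Gp U))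
    (hgl1 : ∀ x U, GlobReads (K x) 1 U (𝔬 x).blkY (𝔬 x).blk (ev x) ((𝔬 x).D U ∘ₗ (𝔬 x).Gp U))
    (hgl2 : ∀ x U, GlobReads (K x) 2 U (𝔬 x).blk (𝔬 x).blkY (evY x) ((𝔬 x).Gp U ∘ₗ (𝔬 x).Dstar U))
    (hgl3 : ∀ x U, GlobReads (K x) 3 U (𝔬 x).blk (𝔬 x).blk (ev x) ((𝔬 x).Lap U ∘ₗ (𝔬 x).Gp U))
    (hl0 : ∀ x U, L2Reads (R := 1) (H := H x) (K x) 0 U (𝔬 x).blk (𝔬 x).blk (ev x) ((𝔬 x).Gp U))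
    (hl1 : ∀ x U, L2Reads (R := 1) (H := H x) (K x) 1 U (𝔬 x).blkY (𝔬 x).blk (ev x) ((𝔬 x).D U ∘ₗ (𝔬 x).Gp U))
    (hl2 : ∀ x U, L2Reads (R := 1) (H := H x) (K x) 2 U (𝔬 x).blk (𝔬 x).blkY (evY x) ((𝔬 x).Gp U ∘ₗ (𝔬 x).Dstar U))
    (hl3 : ∀ x U, L2Reads (R := 1) (H := H x) (K x) 3 U (𝔬 x).blk (𝔬 x).blk (ev x) ((𝔬 x).Lap U ∘ₗ (𝔬 x).Gp U))
    (hl4 : ∀ x U, L2Reads (R := 1) (H := H x) (K x) 4 U (𝔬 x).blkY (𝔬 x).blkY (evY x)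
      ((𝔬 x).D U ∘ₗ ((𝔬 x).Gp U ∘ₗ (𝔬 x).Dstar U)))
    (hl5 : ∀ x U, L2Reads (R := 1) (H := H x) (K x) 5 U (𝔬 x).blk (𝔬 x).blk (ev x) ((𝔬 x).Gp U ∘ₗ (𝔬 x).Lap U))
    (hH1 : ∀ x U, H1Reads (K x) U (𝔭 x) (𝔬 x).blk (𝔬 x).blkY (ev x) (evY x) ((𝔬 x).D U ∘ₗ (𝔬 x).Gp U)
      ((𝔬 x).Gp U ∘ₗ (𝔬 x).Dstar U))
    (hIR : ∀ x U, InputReads (K x) U (𝔭 x) (bH x) (𝔬 x).blkY (evY x) ((𝔬 x).D U ∘ₗ ((𝔬 x).Gp U ∘ₗ (𝔬 x).Dstar U)))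
    (hsym : ∀ x U, IsTransposePair ((𝔬 x).Gp U) ((𝔬 x).Gp U))
    (htr : ∀ x U, IsTransposePair ((𝔬 x).D U ∘ₗ (𝔬 x).Gp U) ((𝔬 x).Gp U ∘ₗ (𝔬 x).Dstar U))
    (hadjL : ∀ x U, IsTransposePair ((𝔬 x).Lap U ∘ₗ (𝔬 x).Gp U) ((𝔬 x).Gp U ∘ₗ (𝔬 x).Lap U))
    (hcntH : ∀ x (a : (geo9Y x).Site), (∑ c, if a ∈ SH x c then (1 : ℝ) else 0) ≤ p.NH)
    (hcntL : ∀ x (a : (geo9Y x).Site), (∑ c, if a ∈ SL x c then (1 : ℝ) else 0) ≤ p.NL)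
    (hcntI : ∀ x (a : (geo9Y x).Site), (∑ c, if a ∈ SI x c then (1 : ℝ) else 0) ≤ p.NI)
    (hcnt2 : ∀ x (a : (geo9Y x).Site), (∑ c, if a ∈ S2 x c then (1 : ℝ) else 0) ≤ p.N2)
    -- the G side (Theorem 3.10)
    (𝔬A : ∀ x : MemberY d ℓ hd hL b₀ b₁ Mstar, Ops310 (geo9Y x) (bg x) (XA x) (YA x) (ιA x) (AA x))
    (rdA : ∀ x : MemberY d ℓ hd hL b₀ b₁ Mstar, WalkReading310 (geo9Y x) (bg x) (XA x) (ιA x) (AA x))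
    (𝔭A : ∀ x : MemberY d ℓ hd hL b₀ b₁ Mstar, HolderProbes (geo9Y x) (bg x) (XA x) (YA x) (PXA x) (PYA x))
    (bHA : ∀ x : MemberY d ℓ hd hL b₀ b₁ Mstar, ℝ → BlockNorm (toB6 (geo9Y x) 1 (H x)) (YA x → ℝ))
    (KA : ∀ x : MemberY d ℓ hd hL b₀ b₁ Mstar, B9.KernelFamily (geo9Y x) (bg x))
    (evA : ∀ x : MemberY d ℓ hd hL b₀ b₁ Mstar, (geo9Y x).Loc → XA x → ℝ)
    (evYA : ∀ x : MemberY d ℓ hd hL b₀ b₁ Mstar, (geo9Y x).Loc → YA x → ℝ)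
    (κA : MemberY d ℓ hd hL b₀ b₁ Mstar → Sizes310)
    (SHA SLA SIA S2A : ∀ x : MemberY d ℓ hd hL b₀ b₁ Mstar, ιA x → Finset (geo9Y x).Site)
    (hstA : ∀ x, StaticOK310 (𝔬A x) q.ρ q.Nc q.N' q.NF q.Cℓ (κA x)) (hκA : ∀ x, (κA x).Bounded q.Kc)
    (hrdA : ∀ x, (rdA x).OK (𝔬A x).blk) (hlocA : ∀ x, Locality310 (𝔬A x) (rdA x))
    (h36A : ∀ x, q.M₁ ≤ (geo9Y x).M → ∀ α₀ : ℝ, 0 < α₀ → c35 * (geo9Y x).M * α₀ ≤ q.a₁ →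
      ∀ U : (bg x).Cfg, (bg x).Reg335 c35 α₀ U →
        Local342G (𝔬A x) 1 (H x) q.B₀ q.δ₀ U ∧ B9Thm310Whole.Factors389 (𝔬A x) 1 (H x) q.θ₀ q.δ₀ U ∧
          Identities310 (𝔬A x) 1 (H x) U)
    (h36HA : ∀ x, q.M₁ ≤ (geo9Y x).M → ∀ α₀ : ℝ, 0 < α₀ → c35 * (geo9Y x).M * α₀ ≤ q.a₁ →
      ∀ U : (bg x).Cfg, (bg x).Reg335 c35 α₀ U →
        HolderLegs310 (𝔬A x) (𝔭A x) 1 (H x) (SHA x) q.Bl q.δ₀ U ∧ FactorsHolder310 (𝔬A x) (𝔭A x) 1 (H x) q.Bt q.δ₀ U ∧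
          LapLegs310 (𝔬A x) 1 (H x) (SLA x) q.BL q.δ₀ U ∧
            InputLegs310 (𝔬A x) (𝔭A x) 1 (H x) (bHA x) (SIA x) q.BI q.BI2 q.δ₀ U ∧
              FactorsInput310 (𝔬A x) 1 (H x) (bHA x) q.θI q.δ₀ U ∧
                L2TwoLegs310 (𝔬A x) 1 (H x) (S2A x) q.B2 q.δ₀ U ∧ FactorsL2_310 (𝔬A x) 1 (H x) q.θ2 q.δ₀ U)
    (hcoA0 : ∀ x U, CoRealizes (KA x) 0 U (𝔬A x).blk (𝔬A x).blk (evA x) ((𝔬A x).G U))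
    (hcoA1 : ∀ x U, CoRealizes (KA x) 1 U (𝔬A x).blkY (𝔬A x).blk (evA x) ((𝔬A x).D U ∘ₗ (𝔬A x).G U))
    (hcoA2 : ∀ x U, CoRealizes (KA x) 2 U (𝔬A x).blk (𝔬A x).blkY (evYA x) ((𝔬A x).G U ∘ₗ (𝔬A x).Dstar U))
    (hcoA3 : ∀ x U, CoRealizes (KA x) 3 U (𝔬A x).blk (𝔬A x).blk (evA x) ((𝔬A x).Lap U ∘ₗ (𝔬A x).G U))
    (hglA0 : ∀ x U, GlobReads (KA x) 0 U (𝔬A x).blk (𝔬A x).blk (evA x) ((𝔬A x).G U))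
    (hglA1 : ∀ x U, GlobReads (KA x) 1 U (𝔬A x).blkY (𝔬A x).blk (evA x) ((𝔬A x).D U ∘ₗ (𝔬A x).G U))
    (hglA2 : ∀ x U, GlobReads (KA x) 2 U (𝔬A x).blk (𝔬A x).blkY (evYA x) ((𝔬A x).G U ∘ₗ (𝔬A x).Dstar U))
    (hglA3 : ∀ x U, GlobReads (KA x) 3 U (𝔬A x).blk (𝔬A x).blk (evA x) ((𝔬A x).Lap U ∘ₗ (𝔬A x).G U))
    (hlA0 : ∀ x U, L2Reads (R := 1) (H := H x) (KA x) 0 U (𝔬A x).blk (𝔬A x).blk (evA x) ((𝔬A x).G U))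
    (hlA1 : ∀ x U, L2Reads (R := 1) (H := H x) (KA x) 1 U (𝔬A x).blkY (𝔬A x).blk (evA x) ((𝔬A x).D U ∘ₗ (𝔬A x).G U))
    (hlA2 : ∀ x U, L2Reads (R := 1) (H := H x) (KA x) 2 U (𝔬A x).blk (𝔬A x).blkY (evYA x) ((𝔬A x).G U ∘ₗ (𝔬A x).Dstar U))
    (hlA3 : ∀ x U, L2Reads (R := 1) (H := H x) (KA x) 3 U (𝔬A x).blk (𝔬A x).blk (evA x) ((𝔬A x).Lap U ∘ₗ (𝔬A x).G U))
    (hlA4 : ∀ x U, L2Reads (R := 1) (H := H x) (KA x) 4 U (𝔬A x).blkY (𝔬A x).blkY (evYA x)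
      ((𝔬A x).D U ∘ₗ ((𝔬A x).G U ∘ₗ (𝔬A x).Dstar U)))
    (hlA5 : ∀ x U, L2Reads (R := 1) (H := H x) (KA x) 5 U (𝔬A x).blk (𝔬A x).blk (evA x) ((𝔬A x).G U ∘ₗ (𝔬A x).Lap U))
    (hH1A : ∀ x U, H1Reads (KA x) U (𝔭A x) (𝔬A x).blk (𝔬A x).blkY (evA x) (evYA x) ((𝔬A x).D U ∘ₗ (𝔬A x).G U)
      ((𝔬A x).G U ∘ₗ (𝔬A x).Dstar U))
    (hIRA : ∀ x U, InputReads (KA x) U (𝔭A x) (bHA x) (𝔬A x).blkY (evYA x) ((𝔬A x).D U ∘ₗ ((𝔬A x).G U ∘ₗ (𝔬A x).Dstar U)))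
    (hsymA : ∀ x U, IsTransposePair ((𝔬A x).G U) ((𝔬A x).G U))
    (htrA : ∀ x U, IsTransposePair ((𝔬A x).D U ∘ₗ (𝔬A x).G U) ((𝔬A x).G U ∘ₗ (𝔬A x).Dstar U))
    (hadjLA : ∀ x U, IsTransposePair ((𝔬A x).Lap U ∘ₗ (𝔬A x).G U) ((𝔬A x).G U ∘ₗ (𝔬A x).Lap U))
    (hcntHA : ∀ x (a : (geo9Y x).Site), (∑ c, if a ∈ SHA x c then (1 : ℝ) else 0) ≤ q.NH)
    (hcntLA : ∀ x (a : (geo9Y x).Site), (∑ c, if a ∈ SLA x c then (1 : ℝ) else 0) ≤ q.NL)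
    (hcntIA : ∀ x (a : (geo9Y x).Site), (∑ c, if a ∈ SIA x c then (1 : ℝ) else 0) ≤ q.NI)
    (hcnt2A : ∀ x (a : (geo9Y x).Site), (∑ c, if a ∈ S2A x c then (1 : ℝ) else 0) ≤ q.N2) :
    B9.Thm37Printed c35 geo9Y bg (fun x => E37Y (bg := bg) p q (𝔬 x) (rd x) (H x) (K x)) ∧
      B9.Cor38Printed c35 geo9Y bg (fun x => E37Y (bg := bg) p q (𝔬 x) (rd x) (H x) (K x)) ∧
      B9.Thm310Printed c35 geo9Y bg (fun x => E310Y (bg := bg) p q (𝔬A x) (rdA x) (H x) (KA x)) ∧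
      B9.RWSumsYieldIneqs geo9Y bg (fun x => E37Y (bg := bg) p q (𝔬 x) (rd x) (H x) (K x))
        (fun x => E310Y (bg := bg) p q (𝔬A x) (rdA x) (H x) (KA x)) K KA := by
  set dp : ℕ := exp261 (@geo9Y d ℓ hd hL b₀ b₁ Mstar) p.δ₀ p.α with hdp
  set dFp : ℕ := exp261 (@geo9Y d ℓ hd hL b₀ b₁ Mstar) ((1 - 2 * p.α) * p.δ₀) (1 - p.αF) with hdFp
  set dq : ℕ := exp261 (@geo9Y d ℓ hd hL b₀ b₁ Mstar) q.δ₀ q.α with hdq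
  set dFq : ℕ := exp261 (@geo9Y d ℓ hd hL b₀ b₁ Mstar) ((1 - 2 * q.α) * q.δ₀) (1 - q.αF) with hdFq
  set L₀ : ℝ := ((ℓ + 1 : ℕ) : ℝ) with hL₀
  have hBp := lowerB_le_B1Y_left p q dp dFp dq dFq L₀
  have hBq := lowerB_le_B1Y_right p q dp dFp dq dFq L₀
  obtain ⟨t37, c38⟩ := thm37_cor38_complete_geo9Y (bg := bg) (B₁ := B1Y p q dp dFp dq dFq L₀) (δ₁ := delta1Y p q)
    (Bβ := BbetaY p q dp dq) (Bε := BepsY p q dp dq L₀) (Bεβ := BepsbetaY p q dp dq L₀) 𝔬 rd H 𝔭 bH K ev evY κ SH SL SI S2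
    p.Bl p.Bt p.BI p.θI p.BI2 p.α p.ρ p.Nc p.N' p.Cℓ p.Kc p.θ₀ p.B₀ p.δ₀ p.a₁ p.M₁ p.αF p.NH p.NL p.BL p.NI p.N2 p.B2 p.θ2 hc
    hp.α_pos hp.α_lt hp.Nc_nn hp.N'_nn hp.one_le_Cℓ hp.Kc_nn hp.θ₀_nn hp.B₀_pos hp.δ₀_pos hp.a₁_pos hp.M₁_pos hp.αF_pos
    hp.αF_lt.le hp.NH_nn hp.NL_nn hp.BL_nn hp.NI_nn hp.N2_nn hp.B2_nn hp.θ2_nn hst hκ hrd hloc h36 h36H hco0 hco1 hco2 hco3 hgl0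
    hgl1 hgl2 hgl3 hl0 hl1 hl2 hl3 hl4 hl5 hH1 hIR hsym htr hadjL hcntH hcntL hcntI hcnt2 hp.Bl_nn hp.Bt_nn hp.BI_nn hp.BI2_nn
    hp.θI_nn ((le_pinLowerB₁ _ _ _ _ _).trans hBp) ((le_pinLowerB₂ _ _ _ _ _).trans hBp) (min_le_left _ _)
    ((le_pinLowerB₃ _ _ _ _ _).trans hBp) ((le_pinLowerB₄ _ _ _ _ _).trans hBp) ((le_pinLowerB₅ _ _ _ _ _).trans hBp)
    (fun β _ _ => le_max_left _ _) (fun ε _ _ => le_max_left _ _) (fun ε β _ _ _ _ => le_max_left _ _)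
  have t310 := thm310_complete_geo9Y (bg := bg) (B₁ := B1Y p q dp dFp dq dFq L₀) (δ₁ := delta1Y p q)
    (Bβ := BbetaY p q dp dq) (Bε := BepsY p q dp dq L₀) (Bεβ := BepsbetaY p q dp dq L₀) 𝔬A rdA H 𝔭A bHA KA evA evYA κA SHA
    SLA SIA S2A q.Bl q.Bt q.BI q.θI q.BI2 q.α q.ρ q.Nc q.N' q.NF q.Cℓ q.Kc q.θ₀ q.B₀ q.δ₀ q.a₁ q.M₁ q.αF q.NH q.NL q.BL q.NI
    q.N2 q.B2 q.θ2 hc hq.α_pos hq.α_lt hq.Nc_nn hq.N'_nn hq.NF_nn hq.one_le_Cℓ hq.Kc_nn hq.θ₀_nn hq.B₀_pos hq.δ₀_pos hq.a₁_pos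
    hq.M₁_pos hq.αF_pos hq.αF_lt.le hq.NH_nn hq.NL_nn hq.BL_nn hq.NI_nn hq.N2_nn hq.B2_nn hq.θ2_nn hstA hκA hrdA hlocA h36A
    h36HA hcoA0 hcoA1 hcoA2 hcoA3 hglA0 hglA1 hglA2 hglA3 hlA0 hlA1 hlA2 hlA3 hlA4 hlA5 hH1A hIRA hsymA htrA hadjLA hcntHA
    hcntLA hcntIA hcnt2A hq.Bl_nn hq.Bt_nn hq.BI_nn hq.BI2_nn hq.θI_nn ((le_pinLowerB₁ _ _ _ _ _).trans hBq)
    ((le_pinLowerB₂ _ _ _ _ _).trans hBq) (min_le_right _ _) ((le_pinLowerB₃ _ _ _ _ _).trans hBq)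
    ((le_pinLowerB₄ _ _ _ _ _).trans hBq) ((le_pinLowerB₅ _ _ _ _ _).trans hBq) (fun β _ _ => le_max_right _ _)
    (fun ε _ _ => le_max_right _ _) (fun ε β _ _ _ _ => le_max_right _ _)
  exact ⟨t37, c38, t310, rwSumsYieldIneqs_allPins _ 𝔬 (fun _ => 1) H _ _ 𝔬A rdA (fun _ => 1) H _ _ K KA _ _ _
    (B1Y_pos p q dp dFp dq dFq L₀) (delta1Y_pos hp hq)⟩

end StageY

end Literature.MathematicalPhysics.QuantumFieldTheory.Balaban1983to89.B9RWSumsDefinitePins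

end
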